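import Summits.QuantumFields.YangMills.Theorems.LangevinControlUVOSLegsFromFemtoAndGapDefsR3
import Summits.QuantumFields.YangMills.Theorems.LangevinControlUVOSLegsFromFemtoAndGapStubAssemblyHermitian
import HarnessLib

/-!
# Stub `stub_gap` of line `dlr-collar-transfer` (crux stmt-QuantumFields-9367, reshape r3): `ConnCS` and `HasMassGap`

`…Cruxes.OSLegsFromFemtoAndGap.DlrCollarTransfer.stub_gap : Statement.stub_gap` (DefsR3 §4.3): for a one-field Schwinger
family `S₁` on `ℝ⁴` with `S₁ 0 = ev`, translation invariance on `⁰𝒮` and `RPPos`: (i) `ConnCS S₁`; (ii) for every `Δ > 0`,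
`Decay S₁ Δ ⇒ S₁.toLabelled.HasMassGap Δ`.  Continuum OS functional analysis for `conn S₁ F G = S₁(ΘF* ⊗ G) − S₁(ΘF*) S₁(G)`:
* (i) `connCS_of_rpPos`: `RPPos` on the tuple `(c₀·𝟙₀, c₁F, c₂G)` of arities `(0, n, m)`, `c₀ = −(c₁ S₁F + c₂ S₁G)`, says that
  the `2 × 2` form `Σ c̄ᵢ cⱼ conn(Fᵢ, Fⱼ)` is real non-negative (`conn_quad_nonneg`; arity casts `0 + k` via `castTest` of toolkit
  XXII), and such a form satisfies Cauchy–Schwarz (`cs_of_quad_nonneg`, discriminant of `t ↦ Q(tb, 1)`).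
* Semigroup law `conn(T_s P, T_s Q) = conn(P, T_{2s} Q)` (time-ordered `P, Q`, `s ≥ 0`) from translation invariance on `⁰𝒮`
  (`Θ(T_sP)* = T_{−s}ΘP*`, `ΘP* ⊗ T_{2s}Q ∈ ⁰𝒮`; OS 1973 (4.7)).
* (ii) `hasMassGap_of_connCS_of_decay` (does not use `Δ > 0`): `Decay` extends to every REAL time-ordered `P` by density at
  fixed `t` (`decay_of_isTimeOrdered`: the cutoffs of `exists_tsupport_subset_inter_closedBall_tendsto` live inside `tsupport P`,
  their symmetrisations `(u + ū)/2` are real, compactly supported, time-ordered, converge to `P`; both sides are continuous).  For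
  real time-ordered `P, Q`: semigroup law at `t/2`, `ConnCS` and the extended decay give
  `‖conn(P, T_tQ)‖ ≤ (Re conn(P,P) Re conn(Q,Q))^{1/2} e^{−Δt}`; complex `F = F₁ + iF₂`, `F₁ = (F + F̄)/2`, `F₂ = i(F̄ − F)/2`
  real time-ordered, and sesquilinearity; the witness `H` of `ΘF* ⊗ T_tG` is `appendTensor` by `ext`, and `S₁(T_tG) = S₁(G)`.
Refs: OsterwalderSchrader1973 §4.1 (4.3)–(4.7); GlimmJaffe1987 §6.1 Thm. 6.1.3, §19.3; JaffeWitten2000 §4.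
-/

set_option autoImplicit false

noncomputable section

open scoped SchwartzMap ComplexConjugate
open MeasureTheory Filter Topology
open Literature.MathematicalPhysics.QuantumFieldTheory Literature.MathematicalPhysics.QuantumLattice
open Literature.MathematicalPhysics.AQFT

namespace Summit.QuantumFields.YangMills.Theorems.OSLegsFromFemtoAndGap

open Summit.QuantumFields.YangMills.Cruxes.OSLegsFromFemtoAndGap.DlrCollarTransfer (conn Decay RPPos ConnCS)

local notation "E4" => EuclideanSpace ℝ (Fin 4)

variable (S₁ : SchwingerFamily E4) {n m : ℕ}

/-- `conn` is additive in the first slot. -/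
theorem conn_add_left (F F' : 𝓢((Fin n → E4), ℂ)) (G : 𝓢((Fin m → E4), ℂ)) :
    conn S₁ (F + F') G = conn S₁ F G + conn S₁ F' G := by
  simp only [conn, osAdjoint_add, SchwartzMap.appendTensor_add_left, map_add]; ring

/-- `conn` is conjugate-homogeneous in the first slot. -/
theorem conn_smul_left (c : ℂ) (F : 𝓢((Fin n → E4), ℂ)) (G : 𝓢((Fin m → E4), ℂ)) :
    conn S₁ (c • F) G = conj c * conn S₁ F G := by
  simp only [conn, osAdjoint_smul, SchwartzMap.appendTensor_smul_left, map_smul, smul_eq_mul]; ring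

/-- `conn` is additive in the second slot. -/
theorem conn_add_right (F : 𝓢((Fin n → E4), ℂ)) (G G' : 𝓢((Fin m → E4), ℂ)) :
    conn S₁ F (G + G') = conn S₁ F G + conn S₁ F G' := by
  simp only [conn, SchwartzMap.appendTensor_add_right, map_add]; ring

/-- `conn` is homogeneous in the second slot. -/
theorem conn_smul_right (c : ℂ) (F : 𝓢((Fin n → E4), ℂ)) (G : 𝓢((Fin m → E4), ℂ)) :
    conn S₁ F (c • G) = c * conn S₁ F G := by
  simp only [conn, SchwartzMap.appendTensor_smul_right, map_smul, smul_eq_mul]; ring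

/-- The constant of arity `0` is positive-time (vacuously). -/
theorem isPositiveTimeMulti_const (c : ℂ) : IsPositiveTimeMulti (SchwartzMap.constOfSubsingleton (D := Fin 0 → E4) c) :=
  fun _ _ i => Fin.elim0 i

/-- The constant of arity `0` is off-diagonal (the coincidence locus of `Fin 0` is empty). -/
theorem isOffDiagonal_const (c : ℂ) : IsOffDiagonal (SchwartzMap.constOfSubsingleton (D := Fin 0 → E4) c) :=
  isOffDiagonal_of_subsingleton _

/-- Scalar multiples of positive-time test functions are positive-time. -/
theorem isPositiveTimeMulti_smul (c : ℂ) {F : 𝓢((Fin n → E4), ℂ)} (hF : IsPositiveTimeMulti F) :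
    IsPositiveTimeMulti (c • F) :=
  (tsupport_smul_subset_right (fun _ : Fin n → E4 => c) (F : (Fin n → E4) → ℂ)).trans hF

/-- **The connected OS form is a positive `2 × 2` form on `(F, G)`**: for positive-time off-diagonal `F, G` and all
`c₁ c₂ : ℂ`, `Σ c̄ᵢ cⱼ conn(Fᵢ, Fⱼ)` is real and non-negative — `RPPos` on the tuple `(c₀·𝟙₀, c₁F, c₂G)` with
`c₀ = −(c₁ S F + c₂ S G)` and `S₁ 0 = ev`. -/
theorem conn_quad_nonneg (hN : ∀ F : 𝓢((Fin 0 → E4), ℂ), S₁ 0 F = F default) (hRP : RPPos S₁)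
    {F : 𝓢((Fin n → E4), ℂ)} {G : 𝓢((Fin m → E4), ℂ)} (hFp : IsPositiveTimeMulti F) (hFo : IsOffDiagonal F)
    (hGp : IsPositiveTimeMulti G) (hGo : IsOffDiagonal G) (c₁ c₂ : ℂ) :
    0 ≤ (conj c₁ * c₁ * conn S₁ F F + conj c₁ * c₂ * conn S₁ F G +
        conj c₂ * c₁ * conn S₁ G F + conj c₂ * c₂ * conn S₁ G G).re ∧
      (conj c₁ * c₁ * conn S₁ F F + conj c₁ * c₂ * conn S₁ F G +
        conj c₂ * c₁ * conn S₁ G F + conj c₂ * c₂ * conn S₁ G G).im = 0 := by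
  set c₀ : ℂ := -(c₁ * S₁ n F + c₂ * S₁ m G) with hc₀
  let deg : Fin 3 → ℕ := Fin.cons 0 (Fin.cons n fun _ => m)
  let F' : (j : Fin 3) → 𝓢((Fin (deg j) → E4), ℂ) :=
    Fin.cons (α := fun j : Fin 3 => 𝓢((Fin (deg j) → E4), ℂ)) (SchwartzMap.constOfSubsingleton (D := Fin 0 → E4) c₀)
      (Fin.cons (α := fun j : Fin 2 => 𝓢((Fin (deg j.succ) → E4), ℂ)) (c₁ • F) fun _ => c₂ • G)
  have hpos : ∀ j, IsPositiveTimeMulti (F' j) := fun j => Fin.cases (isPositiveTimeMulti_const c₀)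
    (fun j => Fin.cases (isPositiveTimeMulti_smul c₁ hFp) (fun _ => isPositiveTimeMulti_smul c₂ hGp) j) j
  have hoff : ∀ j, IsOffDiagonal (F' j) := fun j =>
    Fin.cases (isOffDiagonal_const c₀) (fun j => Fin.cases (hFo.smul c₁) (fun _ => hGo.smul c₂) j) j
  have h := hRP 3 deg F' hpos hoff (fun i j => (osAdjoint (F' i)).appendTensor (F' j))
    (fun i j x => SchwartzMap.appendTensor_apply _ _ x)
  simp only [Fin.sum_univ_three] at h
  have h00 : S₁ (deg 0 + deg 0) ((osAdjoint (F' 0)).appendTensor (F' 0)) = conj c₀ * c₀ := by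
    refine (hN ((osAdjoint (F' 0)).appendTensor (F' 0))).trans ((SchwartzMap.appendTensor_apply _ _ _).trans ?_)
    change osAdjoint (SchwartzMap.constOfSubsingleton (D := Fin 0 → E4) c₀) _ *
      SchwartzMap.constOfSubsingleton (D := Fin 0 → E4) c₀ _ = _
    rw [osAdjoint_const_apply, SchwartzMap.constOfSubsingleton_apply]
  have h0j : ∀ {k : ℕ} (c : ℂ) (X : 𝓢((Fin k → E4), ℂ)),
      S₁ (0 + k) ((osAdjoint (SchwartzMap.constOfSubsingleton (D := Fin 0 → E4) c₀)).appendTensor (c • X)) =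
        conj c₀ * (c * S₁ k X) := by
    intro k c X; refine (schwinger_castTest S₁ (m := 0 + k) (Nat.zero_add k) _).trans ?_
    have hG : castTest (Nat.zero_add k)
        ((osAdjoint (SchwartzMap.constOfSubsingleton (D := Fin 0 → E4) c₀)).appendTensor (c • X)) = (conj c₀ * c) • X := by
      ext x
      refine (SchwartzMap.appendTensor_apply _ _ _).trans ?_
      rw [osAdjoint_const_apply, smul_apply, smul_apply, smul_eq_mul, smul_eq_mul, mul_assoc]
      congr 2; congr 1; funext i; simp only [Function.comp_apply]
      change x (Fin.cast (Nat.zero_add k) (Fin.natAdd 0 i)) = x i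
      congr 1; refine Fin.ext ?_; rw [Fin.val_cast, Fin.val_natAdd]; exact Nat.zero_add _
    rw [hG, map_smul, smul_eq_mul, mul_assoc]
  have hj0 : ∀ {k : ℕ} (c : ℂ) (X : 𝓢((Fin k → E4), ℂ)),
      S₁ (k + 0) ((osAdjoint (c • X)).appendTensor (SchwartzMap.constOfSubsingleton (D := Fin 0 → E4) c₀)) =
        c₀ * (conj c * S₁ k (osAdjoint X)) := by
    intro k c X
    have hG : (osAdjoint (c • X)).appendTensor (SchwartzMap.constOfSubsingleton (D := Fin 0 → E4) c₀) =
        castTest (Nat.add_zero k).symm ((c₀ * conj c) • osAdjoint X) := by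
      ext x
      refine (SchwartzMap.appendTensor_apply _ _ _).trans ?_
      rw [SchwartzMap.constOfSubsingleton_apply, castTest_apply, osAdjoint_smul, smul_apply, smul_apply, smul_eq_mul,
        smul_eq_mul, mul_comm, mul_assoc]
      rfl
    rw [hG, ← schwinger_castTest, map_smul, smul_eq_mul, mul_assoc]
  have hij : ∀ {k l : ℕ} (c c' : ℂ) (X : 𝓢((Fin k → E4), ℂ)) (Y : 𝓢((Fin l → E4), ℂ)),
      S₁ (k + l) ((osAdjoint (c • X)).appendTensor (c' • Y)) = conj c * c' * S₁ (k + l) ((osAdjoint X).appendTensor Y) := by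
    intro k l c c' X Y; rw [osAdjoint_smul, SchwartzMap.appendTensor_smul_left, SchwartzMap.appendTensor_smul_right, map_smul, map_smul,
      smul_eq_mul, smul_eq_mul]
    ring
  have h01 : S₁ (deg 0 + deg 1) ((osAdjoint (F' 0)).appendTensor (F' 1)) = _ := h0j c₁ F
  have h02 : S₁ (deg 0 + deg 2) ((osAdjoint (F' 0)).appendTensor (F' 2)) = _ := h0j c₂ G
  have h10 : S₁ (deg 1 + deg 0) ((osAdjoint (F' 1)).appendTensor (F' 0)) = _ := hj0 c₁ F
  have h20 : S₁ (deg 2 + deg 0) ((osAdjoint (F' 2)).appendTensor (F' 0)) = _ := hj0 c₂ G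
  have h11 : S₁ (deg 1 + deg 1) ((osAdjoint (F' 1)).appendTensor (F' 1)) = _ := hij c₁ c₁ F F
  have h12 : S₁ (deg 1 + deg 2) ((osAdjoint (F' 1)).appendTensor (F' 2)) = _ := hij c₁ c₂ F G
  have h21 : S₁ (deg 2 + deg 1) ((osAdjoint (F' 2)).appendTensor (F' 1)) = _ := hij c₂ c₁ G F
  have h22 : S₁ (deg 2 + deg 2) ((osAdjoint (F' 2)).appendTensor (F' 2)) = _ := hij c₂ c₂ G G
  rw [h00, h01, h02, h10, h20, h11, h12, h21, h22] at h
  have hz : conj c₀ * c₀ + conj c₀ * (c₁ * S₁ n F) + conj c₀ * (c₂ * S₁ m G) +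
      (c₀ * (conj c₁ * S₁ n (osAdjoint F)) + conj c₁ * c₁ * S₁ (n + n) ((osAdjoint F).appendTensor F) +
        conj c₁ * c₂ * S₁ (n + m) ((osAdjoint F).appendTensor G)) +
      (c₀ * (conj c₂ * S₁ m (osAdjoint G)) + conj c₂ * c₁ * S₁ (m + n) ((osAdjoint G).appendTensor F) +
        conj c₂ * c₂ * S₁ (m + m) ((osAdjoint G).appendTensor G)) =
      conj c₁ * c₁ * conn S₁ F F + conj c₁ * c₂ * conn S₁ F G +
        conj c₂ * c₁ * conn S₁ G F + conj c₂ * c₂ * conn S₁ G G := by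
    simp only [conn, hc₀, map_neg, map_add, map_mul]
    ring
  rwa [hz] at h

/-- **Elementary**: if the hermitian-type form `Σ c̄ᵢ cⱼ Mᵢⱼ` with entries `M = [[a, b], [b', d]]` is real and
non-negative for all `c₁ c₂ : ℂ`, then `a ≥ 0` is real and `‖b‖² ≤ a · d` (discriminant of
`t ↦ Q(t b, 1) = ‖b‖² a t² + 2 ‖b‖² t + d`). -/
theorem cs_of_quad_nonneg {a b b' d : ℂ}
    (h : ∀ c₁ c₂ : ℂ,
      0 ≤ (conj c₁ * c₁ * a + conj c₁ * c₂ * b + conj c₂ * c₁ * b' + conj c₂ * c₂ * d).re ∧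
        (conj c₁ * c₁ * a + conj c₁ * c₂ * b + conj c₂ * c₁ * b' + conj c₂ * c₂ * d).im = 0) :
    0 ≤ a.re ∧ a.im = 0 ∧ ‖b‖ ^ 2 ≤ a.re * d.re := by
  have ha := h 1 0; have hd := h 0 1; have h11 := (h 1 1).2; have h1I := (h 1 Complex.I).2
  simp only [map_one, map_zero, one_mul, mul_one, zero_mul, mul_zero, add_zero, zero_add] at ha hd
  refine ⟨ha.1, ha.2, ?_⟩
  simp only [map_one, one_mul, Complex.add_im] at h11
  simp only [map_one, one_mul, mul_one, Complex.conj_I, neg_mul, Complex.I_mul_I, neg_neg, Complex.add_im,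
    Complex.neg_im, Complex.mul_im, Complex.I_re, Complex.I_im, zero_mul, one_mul, zero_add] at h1I
  have hb're : b'.re = b.re := by linarith [ha.2, hd.2]
  have hb'im : b'.im = -b.im := by linarith [ha.2, hd.2]
  have hquad : ∀ t : ℝ, 0 ≤ ‖b‖ ^ 2 * a.re * (t * t) + 2 * ‖b‖ ^ 2 * t + d.re := by
    intro t
    have ht := (h (t * b) 1).1
    convert ht using 1
    simp only [map_mul, Complex.conj_ofReal, map_one, mul_one, one_mul, Complex.add_re, Complex.mul_re,
      Complex.mul_im, Complex.ofReal_re, Complex.ofReal_im, Complex.conj_re, Complex.conj_im, Complex.sq_norm,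
      Complex.normSq_apply, hb're, hb'im, ha.2]
    ring
  have hdisc := discrim_le_zero hquad; rw [discrim] at hdisc
  rcases (sq_nonneg ‖b‖).eq_or_lt with hb0 | hpos
  · rw [← hb0]; exact mul_nonneg ha.1 hd.1
  · nlinarith

/-- **`RPPos` and `S₁ 0 = ev` give `ConnCS`** (Schur complement of the `3 × 3` OS matrix of `(c·𝟙₀, F, G)`). -/
theorem connCS_of_rpPos (S₁ : SchwingerFamily E4) (hN : ∀ F : 𝓢((Fin 0 → E4), ℂ), S₁ 0 F = F default)
    (hRP : RPPos S₁) : ConnCS S₁ := fun _ _ _ _ hFp hFo hGp hGo =>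
  cs_of_quad_nonneg fun c₁ c₂ => conn_quad_nonneg S₁ hN hRP hFp hFo hGp hGo c₁ c₂

/-- `θ (s e₀) = (−s) e₀`. -/
theorem timeReflection_single_time (s : ℝ) :
    timeReflection 4 (EuclideanSpace.single (0 : Fin 4) s) = EuclideanSpace.single 0 (-s) := by
  ext i; rw [timeReflection_apply]
  by_cases hi : i = 0
  · subst hi; simp
  · simp [hi]

/-- **The OS adjoint intertwines a translation with the reflected translation**: `Θ(F_{(a,1)})* = (ΘF*)_{(θa,1)}`. -/
theorem osAdjoint_translateMulti (a : E4) (F : 𝓢((Fin n → E4), ℂ)) :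
    osAdjoint (translateMulti a F) = translateMulti (timeReflection 4 a) (osAdjoint F) := by
  ext x
  simp only [osAdjoint_apply, translateMulti_apply, map_sub, timeReflection_timeReflection]

/-- **Semigroup law** `conn(T_s P, T_s Q) = conn(P, T_{2s} Q)` for time-ordered `P, Q` and `s ≥ 0`: joint translation
invariance of `S₁` on the off-diagonal tensor `ΘP* ⊗ T_{2s} Q` and on `ΘP*`, `Q` (OS 1973 (4.7)). -/
theorem conn_translateMulti_translateMulti
    (htrans : ∀ (n : ℕ) (t : E4) (F : 𝓢((Fin n → E4), ℂ)), IsOffDiagonal F → S₁ n (translateMulti t F) = S₁ n F)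
    {P : 𝓢((Fin n → E4), ℂ)} {Q : 𝓢((Fin m → E4), ℂ)} (hP : IsTimeOrdered P) (hQ : IsTimeOrdered Q) {s : ℝ} (hs : 0 ≤ s) :
    conn S₁ (translateMulti (EuclideanSpace.single 0 s) P) (translateMulti (EuclideanSpace.single 0 s) Q) =
      conn S₁ P (translateMulti (EuclideanSpace.single 0 (s + s)) Q) := by
  set a : E4 := EuclideanSpace.single 0 s with ha
  have hsum : a = timeReflection 4 a + EuclideanSpace.single 0 (s + s) := by
    rw [ha, timeReflection_single_time, ← SchwingerFamily.single_time_add]; congr 1; ring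
  have hQt : IsTimeOrdered (translateMulti (EuclideanSpace.single (0 : Fin 4) (s + s)) Q) :=
    OSReconstructionNoE1.isTimeOrdered_translateMulti hQ (by simp only [PiLp.single_apply, if_true]; linarith)
  have hX : IsOffDiagonal ((osAdjoint P).appendTensor (translateMulti (EuclideanSpace.single (0 : Fin 4) (s + s)) Q)) :=
    OSReconstructionNoE1.isOffDiagonal_appendTensor_osAdjoint hP hQt
  have hTQ : translateMulti a Q = translateMulti (timeReflection 4 a) (translateMulti (EuclideanSpace.single 0 (s + s)) Q) := by
    rw [translateMulti_translateMulti, ← hsum]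
  have h1 : S₁ n (osAdjoint (translateMulti a P)) = S₁ n (osAdjoint P) := by
    rw [osAdjoint_translateMulti]; exact htrans n _ _ hP.isOffDiagonal.osAdjoint
  have h4 : S₁ (n + m) ((osAdjoint (translateMulti a P)).appendTensor (translateMulti a Q)) =
      S₁ (n + m) ((osAdjoint P).appendTensor (translateMulti (EuclideanSpace.single 0 (s + s)) Q)) := by
    rw [osAdjoint_translateMulti, hTQ, ← translateMulti_appendTensor]
    exact htrans _ _ _ hX
  unfold conn; rw [h1, htrans m _ _ hQ.isOffDiagonal, htrans m _ _ hQ.isOffDiagonal, h4]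

/-- The semigroup law at `s = t/2`: `conn(P, T_t Q) = conn(T_{t/2} P, T_{t/2} Q)`. -/
theorem conn_translateMulti_eq_half
    (htrans : ∀ (n : ℕ) (t : E4) (F : 𝓢((Fin n → E4), ℂ)), IsOffDiagonal F → S₁ n (translateMulti t F) = S₁ n F)
    {P : 𝓢((Fin n → E4), ℂ)} {Q : 𝓢((Fin m → E4), ℂ)} (hP : IsTimeOrdered P) (hQ : IsTimeOrdered Q) {t : ℝ} (ht : 0 ≤ t) :
    conn S₁ P (translateMulti (EuclideanSpace.single 0 t) Q) =
      conn S₁ (translateMulti (EuclideanSpace.single 0 (t / 2)) P) (translateMulti (EuclideanSpace.single 0 (t / 2)) Q) := by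
  rw [conn_translateMulti_translateMulti S₁ htrans hP hQ (by positivity : (0 : ℝ) ≤ t / 2), add_halves]

/-- `P ↦ conn(P, T_a P)` is continuous on `𝒮`. -/
theorem continuous_conn_translateMulti (n : ℕ) (a : E4) :
    Continuous fun P : 𝓢((Fin n → E4), ℂ) => conn S₁ P (translateMulti a P) := by
  unfold conn
  exact ((S₁ (n + n)).continuous.comp (continuous_appendTensor.comp
    (continuous_osAdjoint.prodMk (translateMulti a).continuous))).sub
    (((S₁ n).continuous.comp continuous_osAdjoint).mul ((S₁ n).continuous.comp (translateMulti a).continuous))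

/-- `P ↦ conn(P, P)` is continuous on `𝒮`. -/
theorem continuous_conn_self (n : ℕ) : Continuous fun P : 𝓢((Fin n → E4), ℂ) => conn S₁ P P := by
  unfold conn
  exact ((S₁ (n + n)).continuous.comp (continuous_appendTensor.comp (continuous_osAdjoint.prodMk continuous_id))).sub
    (((S₁ n).continuous.comp continuous_osAdjoint).mul (S₁ n).continuous)

/-- Time-ordered test functions are stable under conjugation (same support). -/
theorem isTimeOrdered_starTest {F : 𝓢((Fin n → E4), ℂ)} (hF : IsTimeOrdered F) : IsTimeOrdered (starTest F) :=
  (tsupport_comp_subset (g := (starRingEnd ℂ)) (map_zero _) (F : (Fin n → E4) → ℂ)).trans hF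

/-- Time-ordered test functions are stable under sums. -/
theorem isTimeOrdered_add {F G : 𝓢((Fin n → E4), ℂ)} (hF : IsTimeOrdered F) (hG : IsTimeOrdered G) :
    IsTimeOrdered (F + G) :=
  (tsupport_add (F : (Fin n → E4) → ℂ) (G : (Fin n → E4) → ℂ)).trans (Set.union_subset hF hG)

/-- Time-ordered test functions are stable under differences. -/
theorem isTimeOrdered_sub {F G : 𝓢((Fin n → E4), ℂ)} (hF : IsTimeOrdered F) (hG : IsTimeOrdered G) :
    IsTimeOrdered (F - G) := by
  rw [sub_eq_add_neg, ← neg_one_smul ℂ G]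
  exact isTimeOrdered_add hF (OSReconstructionNoE1.isTimeOrdered_smul _ hG)

/-- The real part `(F + F̄)/2` is real. -/
theorem conj_realPart_apply (F : 𝓢((Fin n → E4), ℂ)) (u : Fin n → E4) :
    conj (((2⁻¹ : ℂ) • (F + starTest F)) u) = ((2⁻¹ : ℂ) • (F + starTest F)) u := by
  simp only [smul_apply, add_apply, starTest_apply, smul_eq_mul, map_mul, map_add, Complex.conj_conj, map_inv₀,
    map_ofNat]
  ring

/-- The imaginary part `i(F̄ − F)/2` is real. -/
theorem conj_imagPart_apply (F : 𝓢((Fin n → E4), ℂ)) (u : Fin n → E4) :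
    conj (((2⁻¹ * Complex.I : ℂ) • (starTest F - F)) u) = ((2⁻¹ * Complex.I : ℂ) • (starTest F - F)) u := by
  simp only [smul_apply, sub_apply, starTest_apply, smul_eq_mul, map_mul, map_sub, Complex.conj_conj, map_inv₀,
    map_ofNat, Complex.conj_I]
  ring

/-- `F = Re F + i Im F`. -/
theorem realPart_add_I_smul_imagPart (F : 𝓢((Fin n → E4), ℂ)) :
    (2⁻¹ : ℂ) • (F + starTest F) + Complex.I • ((2⁻¹ * Complex.I : ℂ) • (starTest F - F)) = F := by
  ext u
  simp only [smul_apply, add_apply, sub_apply, smul_eq_mul]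
  linear_combination (2⁻¹ * (starTest F u - F u)) * Complex.I_mul_I

/-- **Extension of `Decay` by density**: for every REAL time-ordered `P` and `t ≥ 0`,
`Re conn(P, T_t P) ≤ Re conn(P, P) · e^{−Δt}` — cut `P` off to compact support inside its own support, symmetrise to keep
it real, and pass to the limit in the closed condition (both sides are continuous in `P`). -/
theorem decay_of_isTimeOrdered {Δ : ℝ} (hD : Decay S₁ Δ) {P : 𝓢((Fin n → E4), ℂ)} (hP : IsTimeOrdered P)
    (hPr : ∀ u, conj (P u) = P u) {t : ℝ} (ht : 0 ≤ t) :
    (conn S₁ P (translateMulti (EuclideanSpace.single 0 t) P)).re ≤ (conn S₁ P P).re * Real.exp (-(Δ * t)) := by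
  obtain ⟨u, hu_supp, hu_lim⟩ := exists_tsupport_subset_inter_closedBall_tendsto P
  set v : ℕ → 𝓢((Fin n → E4), ℂ) := fun k => (2⁻¹ : ℂ) • (u k + starTest (u k)) with hv
  have hv_supp : ∀ k, tsupport (v k : (Fin n → E4) → ℂ) ⊆ tsupport (u k : (Fin n → E4) → ℂ) := fun k =>
    (tsupport_smul_subset_right (fun _ : Fin n → E4 => (2⁻¹ : ℂ)) _).trans
      ((tsupport_add (u k : (Fin n → E4) → ℂ) (starTest (u k) : (Fin n → E4) → ℂ)).trans
        (Set.union_subset subset_rfl (tsupport_comp_subset (g := (starRingEnd ℂ)) (map_zero _) _)))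
  have hv_lim : Tendsto v atTop (𝓝 P) := by
    have h1 : Tendsto v atTop (𝓝 ((2⁻¹ : ℂ) • (P + starTest P))) :=
      (hu_lim.add ((starTest.continuous.tendsto P).comp hu_lim)).const_smul _
    have h2 : (2⁻¹ : ℂ) • (P + starTest P) = P := by
      ext x; simp only [smul_apply, add_apply, starTest_apply, hPr x, smul_eq_mul]; ring
    rwa [h2] at h1
  have hstep : ∀ k, (conn S₁ (v k) (translateMulti (EuclideanSpace.single 0 t) (v k))).re ≤
      (conn S₁ (v k) (v k)).re * Real.exp (-(Δ * t)) := fun k => by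
    have hTO : IsTimeOrdered (v k) := ((hv_supp k).trans ((hu_supp k).trans Set.inter_subset_left)).trans hP
    refine hD n (v k) hTO.isOffDiagonal hTO.isPositiveTimeMulti ?_ (fun x => conj_realPart_apply (u k) x) t ht
    exact IsCompact.of_isClosed_subset (isCompact_closedBall _ _) (isClosed_tsupport _)
      ((hv_supp k).trans ((hu_supp k).trans Set.inter_subset_right))
  have hclosed : IsClosed {P' : 𝓢((Fin n → E4), ℂ) |
      (conn S₁ P' (translateMulti (EuclideanSpace.single 0 t) P')).re ≤ (conn S₁ P' P').re * Real.exp (-(Δ * t))} :=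
    isClosed_le (Complex.continuous_re.comp (continuous_conn_translateMulti S₁ n _))
      ((Complex.continuous_re.comp (continuous_conn_self S₁ n)).mul continuous_const)
  exact hclosed.mem_of_tendsto hv_lim (Eventually.of_forall hstep)

/-- **The exponential bound for REAL time-ordered `P, Q`**: `‖conn(P, T_t Q)‖ ≤ (Re conn(P,P) · Re conn(Q,Q))^{1/2} e^{−Δt}`
— semigroup law at `t/2`, Cauchy–Schwarz (`ConnCS`) and the extended decay for `P` and for `Q`. -/
theorem norm_conn_translateMulti_le
    (htrans : ∀ (n : ℕ) (t : E4) (F : 𝓢((Fin n → E4), ℂ)), IsOffDiagonal F → S₁ n (translateMulti t F) = S₁ n F)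
    (hCS : ConnCS S₁) {Δ : ℝ} (hD : Decay S₁ Δ) {P : 𝓢((Fin n → E4), ℂ)} {Q : 𝓢((Fin m → E4), ℂ)}
    (hP : IsTimeOrdered P) (hPr : ∀ u, conj (P u) = P u) (hQ : IsTimeOrdered Q) (hQr : ∀ u, conj (Q u) = Q u)
    {t : ℝ} (ht : 0 ≤ t) :
    ‖conn S₁ P (translateMulti (EuclideanSpace.single 0 t) Q)‖ ≤
      Real.sqrt ((conn S₁ P P).re * (conn S₁ Q Q).re) * Real.exp (-(Δ * t)) := by
  have hs' : (0 : ℝ) ≤ (EuclideanSpace.single (0 : Fin 4) (t / 2) : E4) 0 := by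
    simp only [PiLp.single_apply, if_true]; positivity
  set Ps := translateMulti (EuclideanSpace.single (0 : Fin 4) (t / 2)) P with hPs_def
  set Qs := translateMulti (EuclideanSpace.single (0 : Fin 4) (t / 2)) Q with hQs_def
  have hPs : IsTimeOrdered Ps := OSReconstructionNoE1.isTimeOrdered_translateMulti hP hs'
  have hQs : IsTimeOrdered Qs := OSReconstructionNoE1.isTimeOrdered_translateMulti hQ hs'
  obtain ⟨-, -, hCSPQ⟩ := hCS n m Ps Qs hPs.isPositiveTimeMulti hPs.isOffDiagonal hQs.isPositiveTimeMulti hQs.isOffDiagonal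
  obtain ⟨hQQ0, -, -⟩ := hCS m m Qs Qs hQs.isPositiveTimeMulti hQs.isOffDiagonal hQs.isPositiveTimeMulti hQs.isOffDiagonal
  obtain ⟨hPP0', -, -⟩ := hCS n n P P hP.isPositiveTimeMulti hP.isOffDiagonal hP.isPositiveTimeMulti hP.isOffDiagonal
  obtain ⟨hQQ0', -, -⟩ := hCS m m Q Q hQ.isPositiveTimeMulti hQ.isOffDiagonal hQ.isPositiveTimeMulti hQ.isOffDiagonal
  have hPdec : (conn S₁ Ps Ps).re ≤ (conn S₁ P P).re * Real.exp (-(Δ * t)) := by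
    rw [hPs_def, ← conn_translateMulti_eq_half S₁ htrans hP hP ht]
    exact decay_of_isTimeOrdered S₁ hD hP hPr ht
  have hQdec : (conn S₁ Qs Qs).re ≤ (conn S₁ Q Q).re * Real.exp (-(Δ * t)) := by
    rw [hQs_def, ← conn_translateMulti_eq_half S₁ htrans hQ hQ ht]
    exact decay_of_isTimeOrdered S₁ hD hQ hQr ht
  have hRHS : 0 ≤ Real.sqrt ((conn S₁ P P).re * (conn S₁ Q Q).re) * Real.exp (-(Δ * t)) := by positivity
  rw [conn_translateMulti_eq_half S₁ htrans hP hQ ht, ← sq_le_sq₀ (norm_nonneg _) hRHS, mul_pow,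
    Real.sq_sqrt (mul_nonneg hPP0' hQQ0')]
  calc ‖conn S₁ Ps Qs‖ ^ 2 ≤ (conn S₁ Ps Ps).re * (conn S₁ Qs Qs).re := hCSPQ
    _ ≤ ((conn S₁ P P).re * Real.exp (-(Δ * t))) * ((conn S₁ Q Q).re * Real.exp (-(Δ * t))) :=
        mul_le_mul hPdec hQdec hQQ0 (by positivity)
    _ = (conn S₁ P P).re * (conn S₁ Q Q).re * Real.exp (-(Δ * t)) ^ 2 := by ring

/-- **`HasMassGap` from `ConnCS` and `Decay`** (translations on `⁰𝒮`): for time-ordered `F, G` write `F = F₁ + iF₂`,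
`G = G₁ + iG₂` with real time-ordered parts, expand `conn(F, T_t G)` by sesquilinearity and bound the four terms by
`norm_conn_translateMulti_le`; the witness `H` of `ΘF* ⊗ T_t G` is `appendTensor` by extensionality and `S(T_t G) = S(G)`. -/
theorem hasMassGap_of_connCS_of_decay
    (htrans : ∀ (n : ℕ) (t : E4) (F : 𝓢((Fin n → E4), ℂ)), IsOffDiagonal F → S₁ n (translateMulti t F) = S₁ n F)
    (hCS : ConnCS S₁) {Δ : ℝ} (hD : Decay S₁ Δ) : S₁.toLabelled.HasMassGap Δ := by
  intro n m k k' F G hF hG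
  obtain ⟨Fr, hFr⟩ : ∃ X : 𝓢((Fin n → E4), ℂ), X = (2⁻¹ : ℂ) • (F + starTest F) := ⟨_, rfl⟩
  obtain ⟨Fi, hFi⟩ : ∃ X : 𝓢((Fin n → E4), ℂ), X = (2⁻¹ * Complex.I : ℂ) • (starTest F - F) := ⟨_, rfl⟩
  obtain ⟨Gr, hGr⟩ : ∃ X : 𝓢((Fin m → E4), ℂ), X = (2⁻¹ : ℂ) • (G + starTest G) := ⟨_, rfl⟩
  obtain ⟨Gi, hGi⟩ : ∃ X : 𝓢((Fin m → E4), ℂ), X = (2⁻¹ * Complex.I : ℂ) • (starTest G - G) := ⟨_, rfl⟩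
  have hFrT : IsTimeOrdered Fr := hFr ▸ OSReconstructionNoE1.isTimeOrdered_smul _ (isTimeOrdered_add hF (isTimeOrdered_starTest hF))
  have hFiT : IsTimeOrdered Fi := hFi ▸ OSReconstructionNoE1.isTimeOrdered_smul _ (isTimeOrdered_sub (isTimeOrdered_starTest hF) hF)
  have hGrT : IsTimeOrdered Gr := hGr ▸ OSReconstructionNoE1.isTimeOrdered_smul _ (isTimeOrdered_add hG (isTimeOrdered_starTest hG))
  have hGiT : IsTimeOrdered Gi := hGi ▸ OSReconstructionNoE1.isTimeOrdered_smul _ (isTimeOrdered_sub (isTimeOrdered_starTest hG) hG)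
  have hFrR : ∀ u, conj (Fr u) = Fr u := hFr ▸ conj_realPart_apply F
  have hFiR : ∀ u, conj (Fi u) = Fi u := hFi ▸ conj_imagPart_apply F
  have hGrR : ∀ u, conj (Gr u) = Gr u := hGr ▸ conj_realPart_apply G
  have hGiR : ∀ u, conj (Gi u) = Gi u := hGi ▸ conj_imagPart_apply G
  have hFdec : Fr + Complex.I • Fi = F := by rw [hFr, hFi]; exact realPart_add_I_smul_imagPart F
  have hGdec : Gr + Complex.I • Gi = G := by rw [hGr, hGi]; exact realPart_add_I_smul_imagPart G
  refine ⟨Real.sqrt ((conn S₁ Fr Fr).re * (conn S₁ Gr Gr).re) + Real.sqrt ((conn S₁ Fr Fr).re * (conn S₁ Gi Gi).re) +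
    Real.sqrt ((conn S₁ Fi Fi).re * (conn S₁ Gr Gr).re) + Real.sqrt ((conn S₁ Fi Fi).re * (conn S₁ Gi Gi).re),
    fun t ht H hH => ?_⟩
  have hHeq : H = (osAdjoint F).appendTensor (translateMulti (EuclideanSpace.single 0 t) G) := by
    ext x; rw [hH x, SchwartzMap.appendTensor_apply]
  have hred : S₁ (n + m) H - S₁ n (osAdjoint F) * S₁ m G = conn S₁ F (translateMulti (EuclideanSpace.single 0 t) G) := by
    rw [hHeq, conn, htrans m _ _ hG.isOffDiagonal]
  simp only [SchwingerFamily.toLabelled_apply]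
  rw [hred, neg_mul, ← hFdec, ← hGdec, map_add, map_smul, conn_add_left, conn_add_right, conn_add_right,
    conn_smul_right, conn_smul_left, conn_smul_left, conn_smul_right]
  have b1 := norm_conn_translateMulti_le S₁ htrans hCS hD hFrT hFrR hGrT hGrR ht
  have b2 := norm_conn_translateMulti_le S₁ htrans hCS hD hFrT hFrR hGiT hGiR ht
  have b3 := norm_conn_translateMulti_le S₁ htrans hCS hD hFiT hFiR hGrT hGrR ht
  have b4 := norm_conn_translateMulti_le S₁ htrans hCS hD hFiT hFiR hGiT hGiR ht
  refine (norm_add_le _ _).trans ((add_le_add (norm_add_le _ _) (norm_add_le _ _)).trans ?_)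
  simp only [norm_mul, Complex.norm_I, Complex.conj_I, norm_neg, one_mul]
  linarith [b1, b2, b3, b4]

end Summit.QuantumFields.YangMills.Theorems.OSLegsFromFemtoAndGap

namespace Summit.QuantumFields.YangMills.Cruxes.OSLegsFromFemtoAndGap.DlrCollarTransfer

open Summit.QuantumFields.YangMills.Theorems.OSLegsFromFemtoAndGap

/-- **`stub_gap`**: `ConnCS` from `RPPos` and `S₁ 0 = ev`; `HasMassGap Δ` from `ConnCS`, translations and `Decay Δ`. -/
theorem stub_gap : Statement.stub_gap := fun S₁ hN htrans hRP =>
  ⟨connCS_of_rpPos S₁ hN hRP, fun _ _ hD => hasMassGap_of_connCS_of_decay S₁ htrans (connCS_of_rpPos S₁ hN hRP) hD⟩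

end Summit.QuantumFields.YangMills.Cruxes.OSLegsFromFemtoAndGap.DlrCollarTransfer

end
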